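/-
Copyright (c) 2026 the pub-hodgecm-mathlib formalisation cell (harness21).  Prover seat hodgecm-mathlib-LH4-p02 (g8); named by dealer LH4-plan (g7) WORD #51
(2026-09-02 16:38:57Z): the `hce`-discharge adapters in the X-shape, consumers LH5-p04 (g5) (TorusAll) and LH4-p03 (g8) (dispatcher).
-/
import Literature.NumberTheory.Automorphic.UnitaryThreeBorelConjugateCongruencesTrace
import Literature.NumberTheory.Automorphic.UnitaryThreeBorelConjugateCongruencesJZeroTwoThreeTrace
import Literature.NumberTheory.Automorphic.UnitaryThreeBorelNormalFormUnramified
import HarnessLib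

/-!
# Flicker's Prop. 13 in the trace frame: the coset criterion `hce` in the X-shape, discharged from the four congruences

Topic `NumberTheory/Automorphic`; namespace `Literature.NumberTheory.Automorphic.UnitaryGroup`; THEOREMS ONLY (kernel lane).  The coset counts of the `j = 0`
norm-residue cells (★ p852089 HIGH `natCard_cosets_of_iff_norm_sub_le_high_trace`, LH7-p02's NearX) take the conjugation condition as a VALUES-ABSTRACT binder
`hce : ∀ p ∈ P_H, ∀ u x w, ↑p = !![u,0,u·x;0,w,0;0,0,(σu)⁻¹] → (p⁻¹τp ∈ H^K_m ↔ |N(κ(uσu)⁻¹ + x + ξ₀) − ϖ^{2ℓ}γ| ≤ |ϖ^j|)`.  This file PRODUCES that text from the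
corner letters of `τ = !![A,0,B₁;0,b,0;B₂,0,D]` and the level element `u_m^{(y,z)}`: membership in `H^K_m = H ∩ u_m K₀ u_m⁻¹` (★ `mem_flickerHK_iff`) is ★ (C3a)
`borel_conj_mem_unitaryInt_iff_of_rel_normForm` = (1′)∧(2′)∧(3′)∧(4′); in the norm-residue regime (1′) is free, (4′) ⟺ `|N(X) − r(s+r)| ≤ |ϖ^{2m−N}|` by ★ (C3b)
`corner_four_iff_norm_sub_le_trace` (`X = κν⁻¹ + w + r = κ(uσu)⁻¹ + x + ξ₀`, `ξ₀ = z + r`), and (2′)(3′) FOLLOW from (4′): `|X| ≤ |ϖ^{m−N}|` by ★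
`v_le_pow_of_norm_sub_le_of_near_trace` (`|ϖ^j| < |C| = |ϖ^{2ℓ}| ≤ |ϖ^{2(m−N)}|`), then ★ LH4-p01 `conditions_two_three_of_v_le_jzero_trace` (`N ≤ m`) resp. the
level bound `|B₂| ≤ |t|` (`m ≤ N`).  [Flicker1998UnitaryFL, Prop. 13 pp. 91–93, cases (c)(e); Prop. 8 p. 84.]  HONEST LABEL: count-neutral plumbing; HC_CM is proved only
modulo the printed citations until rung 0 closes.
-/

set_option autoImplicit false

open scoped MatrixGroups WithZero
open Matrix

namespace Literature.NumberTheory.Automorphic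

namespace UnitaryGroup

open Literature.NumberTheory.Automorphic.HermitianLattice (unitaryInt mem_unitaryInt_iff UnramifiedLocalConjDatum)

variable {K : Type*} [Field K] [Valued K ℤᵐ⁰] {ϖ : K} (σ : K →+* K) {J : Matrix (Fin 3) (Fin 3) K}

/-! ## §1 Membership of `p⁻¹ τ p` in `H^K_m` through the four congruences (coordinates READ OFF the hypothesis `↑p = !![u,0,u·x;…]`) -/

omit [Valued K ℤᵐ⁰] in
/-- Coordinates are determined by the matrix: `!![u,0,u·x;0,w,0;0,0,(σu)⁻¹] = !![u′,0,u′·x′;0,w′,0;0,0,(σu′)⁻¹]` with `u ≠ 0`... read `u = u′`, `x = x′`, `w = w′`.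
[cite: Flicker1998UnitaryFL, Prop. 8 p. 84] -/
theorem borel_coords_eq {u x w u' x' w' : K} (hu' : u' ≠ 0)
    (h : (!![u, 0, u * x; 0, w, 0; 0, 0, (σ u)⁻¹] : Matrix (Fin 3) (Fin 3) K) = !![u', 0, u' * x'; 0, w', 0; 0, 0, (σ u')⁻¹]) :
    u = u' ∧ x = x' ∧ w = w' := by
  have h00 := congrFun (congrFun h 0) 0
  have h02 := congrFun (congrFun h 0) 2
  have h11 := congrFun (congrFun h 1) 1
  simp only [of_apply, cons_val', cons_val_zero, cons_val_one, cons_val_two, empty_val', cons_val_fin_one] at h00 h02 h11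
  refine ⟨h00, ?_, h11⟩
  rw [h00] at h02
  exact mul_left_cancel₀ hu' h02

/-- **`p⁻¹ τ p ∈ H^K_m` ⟺ the four congruences**, for `τ ∈ H` a corner `!![A,0,B₁;0,b,0;B₂,0,D]`, `p ∈ P_H` with `↑p = !![u,0,u·x;0,w₀,0;0,0,(σu)⁻¹]`, `u_m = u_m^{(y,z)}`
(`|y| = 1`, `z + σz + yσy = 0`), `w = x + z`: ★ `mem_flickerHK_iff` + ★ (C3a) `borel_conj_mem_unitaryInt_iff_of_rel_normForm`, the unit∕skew facts on `u, x, w₀` being read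
from `p ∈ P_H` (★ `exists_coe_eq_borel_of_mem_flickerPH'`). [cite: Flicker1998UnitaryFL, Prop. 8 p. 84; Prop. 10 pp. 85–86] -/
theorem conj_mem_flickerHK_iff_of_rel_normForm (hJ : J = (StdForm.antidiagonal 3).over K) (hd : UnramifiedLocalConjDatum σ ϖ) (h2 : (2 : K) ≠ 0)
    {y z : K} (hy : Valued.v y = 1) (hz : z + σ z + y * σ y = 0) (m : ℕ) {c um τ p : ↥(unitaryGroupOfForm σ J)}
    (hc : ((c : GL (Fin 3) K) : Matrix (Fin 3) (Fin 3) K) = !![1, 0, 0; 0, -1, 0; 0, 0, 1])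
    (hum : ((um : GL (Fin 3) K) : Matrix (Fin 3) (Fin 3) K) = !![ϖ ^ m, y, z * (ϖ ^ m)⁻¹; 0, 1, -σ y * (ϖ ^ m)⁻¹; 0, 0, (ϖ ^ m)⁻¹])
    {A B₁ B₂ D b : K} (hτ : ((τ : GL (Fin 3) K) : Matrix (Fin 3) (Fin 3) K) = !![A, 0, B₁; 0, b, 0; B₂, 0, D])
    (hτH : τ ∈ Subgroup.centralizer ({c} : Set ↥(unitaryGroupOfForm σ J))) (hp : p ∈ flickerPH σ J c) {u x w₀ : K}
    (hpm : ((p : GL (Fin 3) K) : Matrix (Fin 3) (Fin 3) K) = !![u, 0, u * x; 0, w₀, 0; 0, 0, (σ u)⁻¹]) :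
    (p⁻¹ * τ * p ∈ flickerHK σ J c um ↔
      Valued.v ((u * σ u) * B₂) ≤ 1 ∧
      Valued.v (A - b + (u * σ u) * B₂ * σ (x + z)) ≤ Valued.v (ϖ ^ m) ∧
      Valued.v (D - b + (u * σ u) * B₂ * (x + z)) ≤ Valued.v (ϖ ^ m) ∧
      Valued.v (B₁ * (u * σ u)⁻¹ + (A - b) * (x + z) + (D - b) * σ (x + z) + (u * σ u) * B₂ * ((x + z) * σ (x + z))) ≤
        Valued.v (ϖ ^ m) * Valued.v (ϖ ^ m)) ∧
      (Valued.v u = 1 ∧ Valued.v x ≤ 1 ∧ σ x = -x) := by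
  obtain ⟨u', x', w', hcoe', hu1, hx1, hσx', hw1, hσw'⟩ := exists_coe_eq_borel_of_mem_flickerPH' σ hJ hd.σσ hd.vσ h2 hc hp
  have hu'0 : u' ≠ 0 := fun h => by rw [h, map_zero] at hu1; exact zero_ne_one hu1
  obtain ⟨rfl, rfl, rfl⟩ := borel_coords_eq σ hu'0 (hpm.symm.trans hcoe')
  have hu0 : u ≠ 0 := hu'0
  have hσu0 : σ u ≠ 0 := fun h => hu0 (by rw [← hd.σσ u, h, map_zero])
  have hw0 : w₀ ≠ 0 := fun h => by rw [h, map_zero] at hw1; exact zero_ne_one hw1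
  have hpH : p ∈ Subgroup.centralizer ({c} : Set ↥(unitaryGroupOfForm σ J)) := (mem_flickerKH_iff.1 (mem_flickerPH_iff'.1 hp).1).1
  have hconjH : p⁻¹ * τ * p ∈ Subgroup.centralizer ({c} : Set ↥(unitaryGroupOfForm σ J)) :=
    Subgroup.mul_mem _ (Subgroup.mul_mem _ (Subgroup.inv_mem _ hpH) hτH) hpH
  refine ⟨?_, hu1, hx1, hσx'⟩
  rw [mem_flickerHK_iff, and_iff_right hconjH]
  exact borel_conj_mem_unitaryInt_iff_of_rel_normForm σ hJ hd hy hz m hu0 hσu0 hw0 hσx' hum hpm hτ rfl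

/-! ## §2 The X-shape `hce` texts in the norm-residue regime -/

/-- **THE X-SHAPE CRITERION, HIGH∕NEAR-RESIDUE CELLS WITH `N ≤ m`** (the `hce` text of ★ p852089 `natCard_cosets_of_iff_norm_sub_le_high_trace` and of LH7-p02's NearX,
centre `ξ₀ = z + r`): for the unramified datum, the level element `u_m^{(y,z)}` (`|y| = 1`, `z + σz + yσy = 0`, `z + σz = s`), a corner `τ ∈ H` with the `j = 0`
relations `B₁ = κσκB₂`, `A − D = (σκ − κ)B₂` (`|κ + σκ| = 1`), `|B₂| = |ϖ^N|`, `N ≤ m`, the trace-one integer `b₀`, the constants `G`, `r` of ★ (C3b) FILE 1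
(`B₂G = (D − b − κB₂)s`, `r(κ+σκ) = b₀G + σb₀σG`, `|r| ≤ 1`, defect `|G − σG| ≤ |ϖ^{2m−N}|`), and a target `r(s + r) = ϖ^{2ℓ}γ` (`γ` a unit) in the window
`m − N ≤ ℓ`, `2ℓ < j = 2m − N`:  for every `p ∈ P_H` with `↑p = !![u,0,u·x;0,w,0;0,0,(σu)⁻¹]`,
**`p⁻¹ τ p ∈ H^K_m ↔ |N(κ(uσu)⁻¹ + x + ξ₀) − ϖ^{2ℓ}γ| ≤ |ϖ^j|`** — (1′) is free, (4′) is the norm congruence (★ `corner_four_iff_norm_sub_le_trace`), and (2′)(3′) follow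
from it (★ `v_le_pow_of_norm_sub_le_of_near_trace` + ★ `conditions_two_three_of_v_le_jzero_trace`). [cite: Flicker1998UnitaryFL, Prop. 13 (c)(e) pp. 91–93] -/
theorem hce_xshape_of_rel (hJ : J = (StdForm.antidiagonal 3).over K) (hd : UnramifiedLocalConjDatum σ ϖ) (h2 : (2 : K) ≠ 0)
    {y z s : K} (hy : Valued.v y = 1) (hz : z + σ z + y * σ y = 0) (hs : z + σ z = s) {m N j ℓ : ℕ} (hNm : N ≤ m) (hj : j = 2 * m - N)
    (hℓ : m - N ≤ ℓ) (hℓj : 2 * ℓ < j) {c um τ : ↥(unitaryGroupOfForm σ J)}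
    (hc : ((c : GL (Fin 3) K) : Matrix (Fin 3) (Fin 3) K) = !![1, 0, 0; 0, -1, 0; 0, 0, 1])
    (hum : ((um : GL (Fin 3) K) : Matrix (Fin 3) (Fin 3) K) = !![ϖ ^ m, y, z * (ϖ ^ m)⁻¹; 0, 1, -σ y * (ϖ ^ m)⁻¹; 0, 0, (ϖ ^ m)⁻¹])
    {A B₁ B₂ D b κ b₀ G r ξ₀ γ : K} (hτ : ((τ : GL (Fin 3) K) : Matrix (Fin 3) (Fin 3) K) = !![A, 0, B₁; 0, b, 0; B₂, 0, D])
    (hτH : τ ∈ Subgroup.centralizer ({c} : Set ↥(unitaryGroupOfForm σ J))) (hB : Valued.v B₂ = Valued.v (ϖ ^ N))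
    (htr : Valued.v (κ + σ κ) = 1) (hb₀ : b₀ + σ b₀ = 1) (hb₀v : Valued.v b₀ ≤ 1) (hB₁ : B₁ = κ * σ κ * B₂) (hAD : A - D = (σ κ - κ) * B₂)
    (hG : B₂ * G = (D - b - κ * B₂) * s) (hr : r * (κ + σ κ) = b₀ * G + σ b₀ * σ G) (hrv : Valued.v r ≤ 1)
    (hΔ : Valued.v (G - σ G) ≤ Valued.v (ϖ ^ (2 * m - N))) (hξ₀ : ξ₀ = z + r) (hC : r * (s + r) = ϖ ^ (2 * ℓ) * γ) (hγ : Valued.v γ = 1) :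
    ∀ p ∈ flickerPH σ J c, ∀ u x w : K,
      ((p : GL (Fin 3) K) : Matrix (Fin 3) (Fin 3) K) = !![u, 0, u * x; 0, w, 0; 0, 0, (σ u)⁻¹] →
        (p⁻¹ * τ * p ∈ flickerHK σ J c um ↔
          Valued.v ((κ * (u * σ u)⁻¹ + x + ξ₀) * σ (κ * (u * σ u)⁻¹ + x + ξ₀) - ϖ ^ (2 * ℓ) * γ) ≤ Valued.v (ϖ ^ j)) := by
  intro p hp u x w hpm
  obtain ⟨hiff, hu1, hx1, hσx⟩ := conj_mem_flickerHK_iff_of_rel_normForm σ hJ hd h2 hy hz m hc hum hτ hτH hp hpm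
  rw [hiff]
  -- the letters of FILE 1: `ν = uσu`, `w = x + z`, `w + σw = s`, `X = κν⁻¹ + w + r`
  have hν : Valued.v (u * σ u) = 1 := by rw [map_mul, hd.vσ, hu1, mul_one]
  have hσν : σ (u * σ u) = u * σ u := by rw [map_mul, hd.σσ, mul_comm]
  have hws : (x + z) + σ (x + z) = s := by rw [map_add, hσx, ← hs]; ring
  have hvs : Valued.v s = 1 := by
    have e : s = -(y * σ y) := by rw [← hs]; linear_combination hz
    rw [e, Valuation.map_neg, map_mul, hd.vσ, hy, mul_one]
  have htr0 : κ + σ κ ≠ 0 := fun h => by rw [h, map_zero] at htr; exact zero_ne_one htr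
  have hN2 : N ≤ 2 * m := by omega
  have hX : κ * (u * σ u)⁻¹ + (x + z) + r = κ * (u * σ u)⁻¹ + x + ξ₀ := by rw [hξ₀]; ring
  have hΔ' : Valued.v (G - σ G) ≤ Valued.v (ϖ ^ (m - N)) :=
    le_trans hΔ (by rw [hd.v_pow, hd.v_pow, WithZero.exp_le_exp]; omega)
  have h4 := corner_four_iff_norm_sub_le_trace σ hd (A := A) (b := b) (B₁ := B₁) hB hN2 hν hσν hws htr0 hb₀ hb₀v hB₁ hAD hG hr hΔ
  rw [hX, hC, ← hj] at h4
  have h1 : Valued.v ((u * σ u) * B₂) ≤ 1 := by rw [map_mul, hν, one_mul, hB]; exact hd.v_pow_le_one N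
  -- sizes of the target: `|ϖ^j| < |C| = |ϖ^{2ℓ}| ≤ |ϖ^{2(m−N)}|`, `|C| ≤ |ϖ^{m−N}|`
  have hCv : Valued.v (ϖ ^ (2 * ℓ) * γ) = Valued.v (ϖ ^ (2 * ℓ)) := by rw [map_mul, hγ, mul_one]
  have hnear : Valued.v (ϖ ^ j) < Valued.v (ϖ ^ (2 * ℓ) * γ) := by rw [hCv, hd.v_pow, hd.v_pow, WithZero.exp_lt_exp]; omega
  have hfar : Valued.v (ϖ ^ (2 * ℓ) * γ) ≤ Valued.v (ϖ ^ (2 * (m - N))) := by rw [hCv, hd.v_pow, hd.v_pow, WithZero.exp_le_exp]; omega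
  have hCm : Valued.v (r * (s + r)) ≤ Valued.v (ϖ ^ (m - N)) := by rw [hC, hCv, hd.v_pow, hd.v_pow, WithZero.exp_le_exp]; omega
  refine ⟨fun h => h4.1 h.2.2.2, fun h => ⟨h1, ?_⟩⟩
  have hXv : Valued.v (κ * (u * σ u)⁻¹ + (x + z) + r) ≤ Valued.v (ϖ ^ (m - N)) := by
    rw [hX]; exact v_le_pow_of_norm_sub_le_of_near_trace σ hd hnear hfar h
  obtain ⟨h₂, h₃⟩ := conditions_two_three_of_v_le_jzero_trace σ hd (A := A) (b := b) hν hσν hvs hws htr0 hrv hb₀ hb₀v hB hNm hG hAD hr hXv hCm hΔ'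
  exact ⟨h₂, h₃, h4.2 h⟩

/-- **THE X-SHAPE CRITERION, NEAR CELLS WITH `m ≤ N`** (case (c) below the level `N`): same letters, with `N ≤ 2m`, `|G − σG| ≤ |ϖ^{2m−N}|` and the two diagonal congruences
`|A − b|, |D − b| ≤ |t|` as hypotheses — for `m ≤ N` the conditions (2′)(3′) reduce to them (`|νB₂w| ≤ |B₂| ≤ |t|`), so no window on `ℓ` is needed.
[cite: Flicker1998UnitaryFL, Prop. 13 (c) pp. 91–93] -/
theorem hce_xshape_of_rel_of_le (hJ : J = (StdForm.antidiagonal 3).over K) (hd : UnramifiedLocalConjDatum σ ϖ) (h2 : (2 : K) ≠ 0)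
    {y z s : K} (hy : Valued.v y = 1) (hzv : Valued.v z ≤ 1) (hz : z + σ z + y * σ y = 0) (hs : z + σ z = s) {m N j ℓ : ℕ} (hmN : m ≤ N)
    (hN2 : N ≤ 2 * m)
    (hj : j = 2 * m - N) {c um τ : ↥(unitaryGroupOfForm σ J)}
    (hc : ((c : GL (Fin 3) K) : Matrix (Fin 3) (Fin 3) K) = !![1, 0, 0; 0, -1, 0; 0, 0, 1])
    (hum : ((um : GL (Fin 3) K) : Matrix (Fin 3) (Fin 3) K) = !![ϖ ^ m, y, z * (ϖ ^ m)⁻¹; 0, 1, -σ y * (ϖ ^ m)⁻¹; 0, 0, (ϖ ^ m)⁻¹])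
    {A B₁ B₂ D b κ b₀ G r ξ₀ γ : K} (hτ : ((τ : GL (Fin 3) K) : Matrix (Fin 3) (Fin 3) K) = !![A, 0, B₁; 0, b, 0; B₂, 0, D])
    (hτH : τ ∈ Subgroup.centralizer ({c} : Set ↥(unitaryGroupOfForm σ J))) (hB : Valued.v B₂ = Valued.v (ϖ ^ N))
    (htr : Valued.v (κ + σ κ) = 1) (hb₀ : b₀ + σ b₀ = 1) (hb₀v : Valued.v b₀ ≤ 1) (hB₁ : B₁ = κ * σ κ * B₂) (hAD : A - D = (σ κ - κ) * B₂)
    (hG : B₂ * G = (D - b - κ * B₂) * s) (hr : r * (κ + σ κ) = b₀ * G + σ b₀ * σ G)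
    (hΔ : Valued.v (G - σ G) ≤ Valued.v (ϖ ^ (2 * m - N))) (hsA : Valued.v (A - b) ≤ Valued.v (ϖ ^ m)) (hsD : Valued.v (D - b) ≤ Valued.v (ϖ ^ m))
    (hξ₀ : ξ₀ = z + r) (hC : r * (s + r) = ϖ ^ (2 * ℓ) * γ) :
    ∀ p ∈ flickerPH σ J c, ∀ u x w : K,
      ((p : GL (Fin 3) K) : Matrix (Fin 3) (Fin 3) K) = !![u, 0, u * x; 0, w, 0; 0, 0, (σ u)⁻¹] →
        (p⁻¹ * τ * p ∈ flickerHK σ J c um ↔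
          Valued.v ((κ * (u * σ u)⁻¹ + x + ξ₀) * σ (κ * (u * σ u)⁻¹ + x + ξ₀) - ϖ ^ (2 * ℓ) * γ) ≤ Valued.v (ϖ ^ j)) := by
  intro p hp u x w hpm
  obtain ⟨hiff, hu1, hx1, hσx⟩ := conj_mem_flickerHK_iff_of_rel_normForm σ hJ hd h2 hy hz m hc hum hτ hτH hp hpm
  rw [hiff]
  have hν : Valued.v (u * σ u) = 1 := by rw [map_mul, hd.vσ, hu1, mul_one]
  have hσν : σ (u * σ u) = u * σ u := by rw [map_mul, hd.σσ, mul_comm]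
  have hws : (x + z) + σ (x + z) = s := by rw [map_add, hσx, ← hs]; ring
  have htr0 : κ + σ κ ≠ 0 := fun h => by rw [h, map_zero] at htr; exact zero_ne_one htr
  have hX : κ * (u * σ u)⁻¹ + (x + z) + r = κ * (u * σ u)⁻¹ + x + ξ₀ := by rw [hξ₀]; ring
  have h4 := corner_four_iff_norm_sub_le_trace σ hd (A := A) (b := b) (B₁ := B₁) hB hN2 hν hσν hws htr0 hb₀ hb₀v hB₁ hAD hG hr hΔ
  rw [hX, hC, ← hj] at h4
  have hBm : Valued.v B₂ ≤ Valued.v (ϖ ^ m) := by rw [hB, hd.v_pow, hd.v_pow, WithZero.exp_le_exp]; omega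
  have h1 : Valued.v ((u * σ u) * B₂) ≤ 1 := by rw [map_mul, hν, one_mul]; exact le_trans hBm (hd.v_pow_le_one m)
  -- for `m ≤ N` the (2′)(3′) terms `νB₂σw`, `νB₂w` are below the level (`|w| ≤ 1` from `|x|, |z| ≤ 1`)
  have hwv : Valued.v (x + z) ≤ 1 := le_trans (Valuation.map_add _ _ _) (max_le hx1 hzv)
  have hσwv : Valued.v (σ (x + z)) ≤ 1 := by rw [hd.vσ]; exact hwv
  have t2 : Valued.v ((u * σ u) * B₂ * σ (x + z)) ≤ Valued.v (ϖ ^ m) := by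
    rw [map_mul, map_mul, hν, one_mul]; exact le_trans (mul_le_mul' hBm hσwv) (by rw [mul_one])
  have t3 : Valued.v ((u * σ u) * B₂ * (x + z)) ≤ Valued.v (ϖ ^ m) := by
    rw [map_mul, map_mul, hν, one_mul]; exact le_trans (mul_le_mul' hBm hwv) (by rw [mul_one])
  exact ⟨fun h => h4.1 h.2.2.2, fun h => ⟨h1, le_trans (Valuation.map_add _ _ _) (max_le hsA t2),
    le_trans (Valuation.map_add _ _ _) (max_le hsD t3), h4.2 h⟩⟩

end UnitaryGroup

end Literature.NumberTheory.Automorphic
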